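import Summits.BirchSwinnertonDyer.BirchSwinnertonDyer.Theorems.EisensteinPrimesMazurMCOnCellBTwistbackOnePartnerAt
import Summits.BirchSwinnertonDyer.BirchSwinnertonDyer.Theorems.EisensteinPrimesMazurMCOnCellBTwistbackDisplay
import Summits.BirchSwinnertonDyer.BirchSwinnertonDyer.Theorems.EisensteinPrimesMazurMCOnCellBOfNamedFacts
import Literature.NumberTheory.EllipticCurves.GrossZagierRationalPoint
import Literature.NumberTheory.EllipticCurves.QuadraticTwistJInvariantProofs
import Literature.NumberTheory.EllipticCurves.QuadraticTwistLocalPolynomialTwoProofs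
import HarnessLib

/-!
# Crux 3 `MazurMCOnCellB` (stmt-BirchSwinnertonDyer-19033), line `twistback` v8 — THE DEFECT SWAP RUN UPWARDS:
# `BSD(E,p)` at an X2b pair + STEP L over `K` + ONE admissible `K` ⟹ `BSD(E^{(d_K)},p)` at every globally minimal
# model of the rank-ONE partner (a B11 per-pair road with the datum read one twist DOWN)

Width seat bsd-line-x2-p1-w3 (gen 14), cell `bsd-eis`, 2026-08-28; brick F2 of the LEAD g14 WORKER FIT (HOME STATUS l.3942);
`--supports stmt-BirchSwinnertonDyer-19033 --as helper`. HONEST FRAMING: conditional THEOREMS ONLY (no `def`, no named fact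
introduced, no `sorry`); closes no registered stub; no summit statement, no Mazur main conjecture and no case of BSD is proved
for any curve unconditionally; 0 cells / labels / stubs / tiers move.

## What

The twist-back line reads an X2b pair `(W, p)` through its rank-ONE quadratic-twist partner `E^{(d_K)}` (an X2c ∩ `GVPar`
pair) via the display `defect_p(E) = −defect_p(E^K)` (`…TwistbackDisplay.displaySwap_of_indexIdentityAt`, from the
Heegner-index identity over `K`). So far the display ran DOWNWARDS only (`BSDp` at the partner ⟹ `BSDp W p`:
`Rank1ResidualX1RankZeroTwist.bsdp_rankZero_of_displaySwap_of_bsdp_twist`, `…TwistbackOnePartnerAt`). Since v8 (LEAD g14) the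
X2b pairs whose isogeny class carries a rational `p`-unit `#Ш_an` get `BSDp W p` in the skeleton from PUBLISHED inputs
(Wuthrich 2014 Prop. 21 + Cassels, `mazurMC_ofClassShaUnit`). This file runs the display UPWARDS:

* §1 `bsdp_twist_of_displaySwap_of_bsdp_rankZero` — class-agnostic: `BSDp W p` at analytic rank `0` + swapped display +
  `ord_{s=1} L(Wd,s) = 1` ⟹ `BSDp Wd p` (Gross–Zagier I.(7.3) supplies `L′(Wd,1)/(Ω·Reg) ∈ ℚ`).
* §2 `bsdp_partner_of_cellB_of_bsdp_of_kRankOne` — THE BRICK: X2b pair with `BSDp W p` + STEP L = support item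
  `EisensteinPrimes.HeegnerIndexIdentityKRankOne` (stmt-BirchSwinnertonDyer-27489) BY NAME + ONE admissible `K` with
  `ord_{s=1} L(E^{(d_K)},s) = 1` ⟹ `BSDp Wd p` at EVERY globally minimal model `Wd` of `E^{(d_K)}`, every Heegner datum
  DISCHARGED (optimal curve, `X2.cellB_iff_of_isIsogenous`, Darmon Thm. 3.6 `_holds`, Cassels twice); and the upper half.
* §3 the same from v8's Ш-UNIT CLASS DATUM VERBATIM («`∃ W' ∼ W` globally minimal, `#Ш_an(W')` a rational `p`-unit») +
  Wuthrich Prop. 21: every Ш-unit X2b class delivers `BSD(p)` at every admissible rank-one partner.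
* §4 the B11 reading (crux 4 per pair, one twist DOWN, field RAMIFIED for the partner): `V` globally minimal of analytic rank
  one, `W` a minimal model of `V^{(d_K)}` which is X2b with `K` admissible and `BSDp W p` (or a class Ш-unit) ⟹ `BSDp V p`.
* §5 the v8-cone desk: STEP L from Keller–Yin Thm. D (PRE) + Hsieh + LZZ, Poitou–Tate DISCHARGED (x2-p1-w3 g12's
  `…MazurMCOnCellBOfNamedFacts.heegnerIndexIdentityKRankOne_of_thmD_OPEN_of_hsieh_of_thm151_thm153`, p664170).

HYPOTHESES BY NAME (nothing asserted): `EisensteinPrimes.PublishedInputs` (stmt-…-19037; Cassels, parametrisations, newforms,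
Gross–Zagier I.7.3, Gross–Zagier / Kolyvagin over `K`, GZK are used), Mazur 1978 Cor. 4.1, item -27489 (§2–§4) or
{Keller–Yin Thm. D (UNREFEREED PREPRINT), Hsieh, LZZ} (§5), Wuthrich 2014 Prop. 21 (§3–§5). NOT CLAIMED: no field `K` is
produced; nothing class-wide; the registered open stub 6‴ is untouched.

References: [CastellaEtAl2021] Thm. 5.3.1, (5.5)–(5.7); [GrossZagier1986] I.(7.3), V.§2; [KellerYin2024] Thm. D (PRE);
[Mazur1978] Cor. 4.1; [Wuthrich2014] Prop. 21; [MilneADT2006] Thm. I.7.3; [Miller2011LMS] Def. 1.1; [Darmon2004] Thm. 3.6.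
-/

set_option autoImplicit false
-- `Summit.BirchSwinnertonDyer.BirchSwinnertonDyer.…`: the summit and its single sub-problem share a name.
set_option linter.dupNamespace false

noncomputable section

open scoped Classical MatrixGroups ModularForm

open CongruenceSubgroup WeierstrassCurve NumberField
  Literature.NumberTheory.EllipticCurves
  Literature.NumberTheory.EllipticCurves.ModularForms
  Literature.NumberTheory.QuadraticFields
  Literature.NumberTheory.EllipticCurves.Rank1Residual
  Literature.NumberTheory.EllipticCurves.Rank1Residual.Typed
  Literature.NumberTheory.EllipticCurves.Wuthrich2014
  Literature.NumberTheory.EllipticCurves.SteinWuthrich2013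
  Literature.NumberTheory.EllipticCurves.GreenbergVatsal2000
  Literature.NumberTheory.EllipticCurves.KellerYin2024
  Literature.NumberTheory.GaloisCohomology
  Summit.BirchSwinnertonDyer.Rank1Residual
  Summit.BirchSwinnertonDyer.BirchSwinnertonDyer.Theses
  Summit.BirchSwinnertonDyer.BirchSwinnertonDyer.Theorems
  Summit.BirchSwinnertonDyer.BirchSwinnertonDyer.Theorems.EisensteinPrimesMazurMCOnCellBOfNamedFacts

namespace Summit.BirchSwinnertonDyer.BirchSwinnertonDyer.Theorems.EisensteinPrimesMazurMCOnCellBTwistbackDefectSwapUp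

/-! ## §1. Class-agnostic bookkeeping: the swapped display run UPWARDS -/

/-- **`BSD(E,p)` in analytic rank `0` + swapped display ⟹ `BSD(Wd,p)` at a rank-ONE curve `Wd`** (bookkeeping; the
converse orientation of `Rank1ResidualX1RankZeroTwist.bsdp_rankZero_of_displaySwap_of_bsdp_twist`). For `W/ℚ` globally
minimal elliptic with `ord_{s=1} L(E,s) = 0` and `BSDp W p`, ANY globally minimal elliptic `Wd` with `ord_{s=1} L(Wd,s) = 1`,
and the display `hdisp` in the swapped orientation (`defect_p(E) = −defect_p(Wd)` on rational values): Miller's `BSDp Wd p`.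
Inputs: modularity (`hmod`), GZK (`hGZK`), Gross–Zagier I.(7.3) (`hGZ73`: `L′(Wd,1)/(Ω·Reg) ∈ ℚ`). Proof: `BSDp W p` ⟹
the rank-zero print shape (`pPart_of_bsdp`, `pPartRankZero_of_pPart`), so the left side of `hdisp` vanishes; hence the
print shape at `Wd` and `bsdp_of_pPart`. [cite: Miller2011LMS, Def. 1.1 (arXiv:1010.2431 p. 3)] [cite: GrossZagier1986, Thm. I.(7.3)]
[cite: KellerYin2024, proof of Thm. 4.2.1 (p. 22), the display, roles of E and E^K exchanged] -/
theorem bsdp_twist_of_displaySwap_of_bsdp_rankZero (hmod : hasEntireLFunction_rat)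
    (hGZK : rank_eq_analyticRank_of_analyticRank_le_one) (hGZ73 : GrossZagier1986_thm_I_7_3)
    (W : WeierstrassCurve ℚ) [W.IsElliptic] [W.IsGloballyMinimal] (p : ℕ) [Fact p.Prime]
    (hr : W.analyticRank = 0) (hB : BSDp W p)
    (Wd : WeierstrassCurve ℚ) [Wd.IsElliptic] [Wd.IsGloballyMinimal] (hrd : Wd.analyticRank = 1)
    (hdisp : ∀ (q qd : ℚ), W.entireLFunction 1 / (W.realPeriodRat : ℂ) = (q : ℂ) →
        Wd.leadingLCoeff / ((Wd.realPeriodRat * Wd.regulator : ℝ) : ℂ) = (qd : ℂ) →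
        padicValRat p q - ((padicValNat p W.shaOrder : ℤ) + padicValNat p W.tamagawaProduct -
            2 * padicValNat p W.torsionOrder) =
          -(padicValRat p qd - ((padicValNat p Wd.shaOrder : ℤ) + padicValNat p Wd.tamagawaProduct -
            2 * padicValNat p Wd.torsionOrder))) :
    BSDp Wd p := by
  -- the rank-zero print shape at `W` from `BSDp W p`
  obtain ⟨q, hq, hv⟩ := pPartRankZero_of_pPart hGZK W p hr (pPart_of_bsdp hmod hGZK W p (by omega) hB)
  -- `L′(Wd,1)/(Ω·Reg) ∈ ℚ` (Gross–Zagier I.(7.3) with GZK)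
  have hrk : Wd.mordellWeilRank = 1 := by rw [(hGZK Wd hrd.le).1, hrd]
  obtain ⟨qd, -, hqd'⟩ := leadingLCoeff_eq_rat_mul_of_analyticRank_eq_one (W := Wd) hGZ73 hrd hrk
  have hΩR : ((Wd.realPeriodRat * Wd.regulator : ℝ) : ℂ) ≠ 0 := by
    exact_mod_cast (mul_pos Wd.realPeriodRat_pos_holds Wd.regulator_pos').ne'
  have hqd : Wd.leadingLCoeff / ((Wd.realPeriodRat * Wd.regulator : ℝ) : ℂ) = (qd : ℂ) := by
    rw [div_eq_iff hΩR, hqd']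
    push_cast
    ring
  -- the display forces the valuation of `qd`
  have h := hdisp q qd hq hqd
  have hvd : padicValRat p qd = (padicValNat p Wd.shaOrder : ℤ) + padicValNat p Wd.tamagawaProduct -
      2 * padicValNat p Wd.torsionOrder := by
    rw [hv] at h
    linarith
  exact bsdp_of_pPart Wd p hmod hGZK hrd.le ⟨qd, hqd, hvd⟩

/-! ## §2. THE BRICK: `BSDp` at an X2b pair + STEP L (item -27489 BY NAME) + ONE admissible `K` ⟹ `BSDp` at the partner -/

/-- **DEFECT SWAP UP, per pair, every Heegner datum DISCHARGED.** Data: `X2.CellB W p` with `BSDp W p`; `K` imaginary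
quadratic, Heegner for `N_W` and for `p`, `d_K` odd `< −4`, `ord_{s=1} L(E^{(d_K)},s) = 1`; `Wd` ANY globally minimal model
of `E^{(d_K)}`. Named facts BY NAME: `PublishedInputs` (Cassels, parametrisations, newforms, Gross–Zagier I.7.3,
Gross–Zagier / Kolyvagin over `K`, GZK), Mazur 1978 Cor. 4.1 (`hMaz`), STEP L = the support item
`EisensteinPrimes.HeegnerIndexIdentityKRankOne` (stmt-BirchSwinnertonDyer-27489, `hSL`, consumed at `r_an = 0 + 1`).
Conclusion: `BSDp Wd p`. Proof: optimal curve `W₀ ∼ W` with `p ∤ c` (`X2.exists_isIsogenous_hasPrimeToManinDatum`), X2b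
along the isogeny (`X2.cellB_iff_of_isIsogenous`), `N_{W₀} = N_W`, Heegner datum and point (Darmon Thm. 3.6 `_holds`), a
minimal model `Wd₀` of `E₀^{(d_K)}`, `BSDp W₀ p` by Cassels, the display at `(W₀, Wd₀)` from `hSL`
(`…TwistbackDisplay.displaySwap_of_indexIdentityAt`), §1, Cassels from `Wd₀` to `Wd`. CONDITIONAL on the named facts.
[cite: CastellaEtAl2021, Thm. 5.3.1 and (5.5)–(5.7)] [cite: KellerYin2024, Thm. D (5.1.3) and §7 (what hSL would need; hypothesis)]
[cite: Mazur1978, Cor. 4.1] [cite: Darmon2004, Thm. 3.6] [cite: MilneADT2006, Thm. I.7.3] [cite: Miller2011LMS, Def. 1.1] -/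
theorem bsdp_partner_of_cellB_of_bsdp_of_kRankOne (hP : EisensteinPrimes.PublishedInputs)
    (hMaz : mazur_not_dvd_maninConstant_of_odd) (hSL : EisensteinPrimes.HeegnerIndexIdentityKRankOne)
    (W : WeierstrassCurve ℚ) [W.IsElliptic] [W.IsGloballyMinimal] (p : ℕ) [Fact p.Prime] (hc : X2.CellB W p)
    (hB : BSDp W p)
    (K : Type) [Field K] [NumberField K] (hK : IsImaginaryQuadratic K)
    (hHN : SatisfiesHeegnerHypothesis (W.conductorNorm ℤ) K) (hHp : SatisfiesHeegnerHypothesis p K)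
    (hoddK : Odd (NumberField.discr K)) (hlt : NumberField.discr K < -4)
    (hr1 : (W.quadraticTwist (NumberField.discr K : ℚ)).analyticRank = 1)
    (Wd : WeierstrassCurve ℚ) [Wd.IsElliptic] [Wd.IsGloballyMinimal]
    (hWd : ∃ C : VariableChange ℚ, C • Wd = W.quadraticTwist (NumberField.discr K : ℚ)) : BSDp Wd p := by
  have hCassels := hP.2.1
  have hpar := hP.2.2.2.2.1
  have hnf := hP.2.2.2.2.2.1
  have hGZ73 := hP.2.2.2.2.2.2.2.1
  have hGZ := hP.2.2.2.2.2.2.2.2.1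
  have hKo := hP.2.2.2.2.2.2.2.2.2.1
  have hGZK := hP.2.2.2.2.2.2.2.2.2.2.1
  have hE : WeierstrassCurve.hasEntireLFunction_rat :=
    WeierstrassCurve.hasEntireLFunction_rat_of_exists_isNewformOf hnf
  have hHP : ∀ (N : ℕ) [NeZero N] (W : WeierstrassCurve ℚ) (K : Type) [Field K] [NumberField K],
      heegnerPointComplex_mem_range_map N W K :=
    fun N _ W K _ _ ↦ heegnerPointComplex_mem_range_map_holds N W K
  have hEd : edixhoven_optimalManinConstant_integral :=
    ModularForms.edixhoven_optimalManinConstant_integral_holds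
  have hp2 : p ≠ 2 := hc.2.1.1
  have hmult : W.HasMultiplicativeReductionAtPrime p := hc.2.1.2.2
  have hr : W.analyticRank = 0 := hc.1
  obtain ⟨C, hC⟩ := hWd
  have hd0 : (NumberField.discr K : ℚ) ≠ 0 := by exact_mod_cast NumberField.discr_ne_zero K
  haveI := W.isElliptic_quadraticTwist hd0
  have hrd : Wd.analyticRank = 1 := by
    have h := congrArg WeierstrassCurve.analyticRank hC
    rw [analyticRank_smul] at h
    exact h.trans hr1
  obtain ⟨W₀, hE₀, hM₀, hiso, hMan⟩ :=
    X2.exists_isIsogenous_hasPrimeToManinDatum hEd hMaz hpar hnf W p hp2 hmult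
  haveI := hE₀
  haveI := hM₀
  have hc₀ : X2.CellB W₀ p :=
    (X2.cellB_iff_of_isIsogenous (p := p) TateCurve.Silverman1994_thmV53_tateUniformisation_holds
      TateCurve.Silverman1994_thmV53_corV54_tateUniformisation_holds hiso).mp hc
  have hr₀ : W₀.analyticRank = 0 := hc₀.1
  have hred₀ : ¬ W₀.HasIrreducibleModPGaloisRep p := hc₀.2.1.2.1
  have hmult₀ : W₀.HasMultiplicativeReductionAtPrime p := hc₀.2.1.2.2
  haveI : NeZero (W₀.conductorNorm ℤ) := ⟨(W₀.conductorNorm_pos_holds).ne'⟩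
  obtain ⟨Dt, hcM⟩ := hMan
  have hN : W.conductorNorm ℤ = W₀.conductorNorm ℤ :=
    conductorNorm_eq_of_isIsogenous_of_modularity_of_isGloballyMinimal hpar hiso
  have hHN₀ : SatisfiesHeegnerHypothesis (W₀.conductorNorm ℤ) K := hN ▸ hHN
  haveI := W₀.isElliptic_quadraticTwist hd0
  have hisoT : IsIsogenous (W.quadraticTwist (NumberField.discr K : ℚ))
      (W₀.quadraticTwist (NumberField.discr K : ℚ)) := hiso.quadraticTwist hd0
  have h1₀ : (W₀.quadraticTwist (NumberField.discr K : ℚ)).analyticRank = 1 := by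
    rw [← analyticRank_eq_of_isIsogenous' hisoT]; exact hr1
  obtain ⟨β, hβ⟩ := exists_dvd_sq_sub_discr_holds (W₀.conductorNorm ℤ) K hK hHN₀
  obtain ⟨H, -⟩ := nonempty_heegnerDatum_holds (W₀.conductorNorm ℤ) K hK hβ
  obtain ⟨ι⟩ : Nonempty (K →+* ℂ) := inferInstance
  obtain ⟨P, hPt⟩ := hHP (W₀.conductorNorm ℤ) W₀ K hK hHN₀ Dt H ι
  obtain ⟨Wd₀, _, _, C₀, hC₀⟩ := exists_isGloballyMinimal_smul_eq_quadraticTwist W₀ hd0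
  have hrd₀ : Wd₀.analyticRank = 1 := by
    have h := congrArg WeierstrassCurve.analyticRank hC₀
    rw [analyticRank_smul] at h
    exact h.trans h1₀
  have hisod : IsIsogenous Wd₀ Wd :=
    ((isIsogenous_of_smul_eq hC₀).trans' hisoT.symm_of_charZero).trans' (isIsogenous_of_smul_eq' hC)
  have hB₀ : BSDp W₀ p :=
    X2.bsdp_of_isIsogenous_of_bsdp hCassels hGZK hE W W₀ hiso p (by rw [hr]; omega) hB
  have hid : Finite (W₀.baseChange K).sha → X11b.IndexIdentityAt W₀ p K P := fun hfin ↦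
    hSL W₀ p (W₀.conductorNorm ℤ) K Dt H ι P hp2 hmult₀ hred₀ (by rw [hr₀, h1₀]) rfl hK hoddK hlt hHN₀
      hPt hcM hfin
  have hBd₀ : BSDp Wd₀ p :=
    bsdp_twist_of_displaySwap_of_bsdp_rankZero hE hGZK hGZ73 W₀ p hr₀ hB₀ Wd₀ hrd₀
      (EisensteinPrimesMazurMCOnCellBTwistbackDisplay.displaySwap_of_indexIdentityAt W₀ p
        (W₀.conductorNorm ℤ) K Dt H ι P (hGZ _ W₀ K) (hKo _ W₀ K) hGZK hE hK hoddK hlt rfl hHN₀ hHp hPt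
        hp2 hcM hr₀ Wd₀ ⟨C₀, hC₀⟩ hrd₀ hid)
  exact X2.bsdp_of_isIsogenous_of_bsdp hCassels hGZK hE Wd₀ Wd hisod p (by rw [hrd₀]) hBd₀

/-- **The UPPER (Euler-system) half `Typed.MissingUpperBoundAt Wd p` at the partner** (the last clause of the registered
stub's ∃-PARTNER conclusion), from `bsdp_partner_of_cellB_of_bsdp_of_kRankOne` (`BSDp ⟹ MissingPPartAt ⟹ both halves`,
`Ш(Wd)` finite by GZK). CONDITIONAL. [cite: Miller2011LMS, Def. 1.1] [cite: KellerYin2024, Thm. D (5.1.3) and §7 (hypothesis)] -/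
theorem missingUpperBoundAt_partner_of_cellB_of_bsdp_of_kRankOne (hP : EisensteinPrimes.PublishedInputs)
    (hMaz : mazur_not_dvd_maninConstant_of_odd) (hSL : EisensteinPrimes.HeegnerIndexIdentityKRankOne)
    (W : WeierstrassCurve ℚ) [W.IsElliptic] [W.IsGloballyMinimal] (p : ℕ) [Fact p.Prime] (hc : X2.CellB W p)
    (hB : BSDp W p)
    (K : Type) [Field K] [NumberField K] (hK : IsImaginaryQuadratic K)
    (hHN : SatisfiesHeegnerHypothesis (W.conductorNorm ℤ) K) (hHp : SatisfiesHeegnerHypothesis p K)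
    (hoddK : Odd (NumberField.discr K)) (hlt : NumberField.discr K < -4)
    (hr1 : (W.quadraticTwist (NumberField.discr K : ℚ)).analyticRank = 1)
    (Wd : WeierstrassCurve ℚ) [Wd.IsElliptic] [Wd.IsGloballyMinimal]
    (hWd : ∃ C : VariableChange ℚ, C • Wd = W.quadraticTwist (NumberField.discr K : ℚ)) :
    MissingUpperBoundAt Wd p := by
  have hGZK := hP.2.2.2.2.2.2.2.2.2.2.1
  obtain ⟨C, hC⟩ := hWd
  have hd0 : (NumberField.discr K : ℚ) ≠ 0 := by exact_mod_cast NumberField.discr_ne_zero K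
  haveI := W.isElliptic_quadraticTwist hd0
  have hrd : Wd.analyticRank = 1 := by
    have h := congrArg WeierstrassCurve.analyticRank hC
    rw [analyticRank_smul] at h
    exact h.trans hr1
  haveI : Finite Wd.sha := (hGZK Wd hrd.le).2
  exact (lower_and_upper_of_missingPPartAt Wd p (missingPPartAt_of_bsdp Wd p
    (bsdp_partner_of_cellB_of_bsdp_of_kRankOne hP hMaz hSL W p hc hB K hK hHN hHp hoddK hlt hr1 Wd ⟨C, hC⟩))).2

/-! ## §3. Every Ш-UNIT X2b class delivers its rank-one partners (v8's class datum VERBATIM + Wuthrich Prop. 21) -/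

/-- **`BSDp` at an X2b pair from a `p`-unit `#Ш_an` ANYWHERE in its `ℚ`-isogeny class** (v8's class datum VERBATIM):
`(W', p)` is X2b along the isogeny (`X2.cellB_iff_of_isIsogenous`), `L(W',1) ≠ 0`, Wuthrich 2014 Prop. 21 (`hW21`) closes
`BSDp W' p` (`Wuthrich2014.bsdp_of_L_one_ne_zero_of_padicValRat_shaAn_eq_zero`), Cassels carries it to `W` — the `BSDp` half
of the skeleton's `mazurMC_ofClassShaUnit` (v8), Theorems side. CONDITIONAL.
[cite: Wuthrich2014, Prop. 21 (p. 400)] [cite: MilneADT2006, Thm. I.7.3 (Cassels)] [cite: Miller2011LMS, Def. 1.1] -/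
theorem bsdp_of_cellB_of_classShaUnit (hP : EisensteinPrimes.PublishedInputs) (hW21 : sha_dvd_analyticSha)
    (W : WeierstrassCurve ℚ) [W.IsElliptic] [W.IsGloballyMinimal] (p : ℕ) [Fact p.Prime] (hc : X2.CellB W p)
    (h0 : ∃ (W' : WeierstrassCurve ℚ) (_ : W'.IsElliptic) (_ : W'.IsGloballyMinimal),
      IsIsogenous W W' ∧ ∃ q : ℚ, shaAn W' = (q : ℂ) ∧ padicValRat p q = 0) : BSDp W p := by
  have hCassels := hP.2.1
  have hnf := hP.2.2.2.2.2.1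
  have hGZK := hP.2.2.2.2.2.2.2.2.2.2.1
  have hE : WeierstrassCurve.hasEntireLFunction_rat :=
    WeierstrassCurve.hasEntireLFunction_rat_of_exists_isNewformOf hnf
  obtain ⟨W', _, _, hiso, hunit⟩ := h0
  have hc' : X2.CellB W' p :=
    (X2.cellB_iff_of_isIsogenous (p := p) TateCurve.Silverman1994_thmV53_tateUniformisation_holds
      TateCurve.Silverman1994_thmV53_corV54_tateUniformisation_holds hiso).mp hc
  have hL' : W'.entireLFunction 1 ≠ 0 := (W'.analyticRank_eq_zero_iff_holds (hE W')).1 hc'.1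
  have hbsd' : BSDp W' p :=
    bsdp_of_L_one_ne_zero_of_padicValRat_shaAn_eq_zero hW21 hGZK W' p hc'.2.1.1 hL'
      (WeierstrassCurve.HasMultiplicativeReduction.not_hasAdditiveReduction (R := ℤ_[p]) hc'.2.1.2.2)
      (Or.inl hc'.2.1.2.1) hunit
  exact X2.bsdp_of_isIsogenous_of_bsdp hCassels hGZK hE W' W hiso.symm_of_charZero p (by rw [hc'.1]; omega) hbsd'

/-- **EVERY Ш-UNIT X2b CLASS DELIVERS ITS RANK-ONE PARTNERS**: at an X2b pair `(W, p)` carrying v8's class datum (a globally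
minimal `W' ∼ W` with `#Ш_an(W')` a rational `p`-unit), STEP L (item -27489 BY NAME) and ONE admissible `K` with
`ord_{s=1} L(E^{(d_K)},s) = 1` give `BSDp Wd p` at every globally minimal model `Wd` of `E^{(d_K)}` — a row-B11 pair closed PER
PAIR with the unit read one twist DOWN. Named facts: `PublishedInputs`, Wuthrich Prop. 21, Mazur Cor. 4.1, item -27489.
CONDITIONAL. [cite: Wuthrich2014, Prop. 21 (p. 400)] [cite: CastellaEtAl2021, Thm. 5.3.1 and (5.5)–(5.7)]
[cite: KellerYin2024, Thm. D (5.1.3) and §7 (what hSL would need; hypothesis)] [cite: MilneADT2006, Thm. I.7.3] -/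
theorem bsdp_partner_of_cellB_of_classShaUnit_of_kRankOne (hP : EisensteinPrimes.PublishedInputs)
    (hW21 : sha_dvd_analyticSha) (hMaz : mazur_not_dvd_maninConstant_of_odd)
    (hSL : EisensteinPrimes.HeegnerIndexIdentityKRankOne)
    (W : WeierstrassCurve ℚ) [W.IsElliptic] [W.IsGloballyMinimal] (p : ℕ) [Fact p.Prime] (hc : X2.CellB W p)
    (h0 : ∃ (W' : WeierstrassCurve ℚ) (_ : W'.IsElliptic) (_ : W'.IsGloballyMinimal),
      IsIsogenous W W' ∧ ∃ q : ℚ, shaAn W' = (q : ℂ) ∧ padicValRat p q = 0)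
    (K : Type) [Field K] [NumberField K] (hK : IsImaginaryQuadratic K)
    (hHN : SatisfiesHeegnerHypothesis (W.conductorNorm ℤ) K) (hHp : SatisfiesHeegnerHypothesis p K)
    (hoddK : Odd (NumberField.discr K)) (hlt : NumberField.discr K < -4)
    (hr1 : (W.quadraticTwist (NumberField.discr K : ℚ)).analyticRank = 1)
    (Wd : WeierstrassCurve ℚ) [Wd.IsElliptic] [Wd.IsGloballyMinimal]
    (hWd : ∃ C : VariableChange ℚ, C • Wd = W.quadraticTwist (NumberField.discr K : ℚ)) : BSDp Wd p :=
  bsdp_partner_of_cellB_of_bsdp_of_kRankOne hP hMaz hSL W p hc (bsdp_of_cellB_of_classShaUnit hP hW21 W p hc h0)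
    K hK hHN hHp hoddK hlt hr1 Wd hWd

/-! ## §4. The B11 reading: a rank-one curve whose twist DOWN by `K` is a closed X2b pair -/

/-- **Twisting twice by `d` comes back**: from `C • W = V^{(d)}` one gets `C' • V = W^{(d)}` for some change of variables
`C'` (`(C⁻¹ • V^{(d)})^{(d)} = C₁ • (V^{(d)})^{(d)}`, `(V^{(d)})^{(d)} = V^{(d²)} = D • V`; `quadraticTwist_smul`,
`exists_quadraticTwist_quadraticTwist_eq_smul`). Bookkeeping. [cite: SilvermanAEC2009, X.2 Prop. 2.4 and X.5 Cor. 5.4] -/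
theorem exists_smul_eq_quadraticTwist_symm (V W : WeierstrassCurve ℚ) {d : ℚ} (hd : d ≠ 0)
    {C : VariableChange ℚ} (hC : C • W = V.quadraticTwist d) :
    ∃ C' : VariableChange ℚ, C' • V = W.quadraticTwist d := by
  obtain ⟨D, hD⟩ := exists_quadraticTwist_quadraticTwist_eq_smul V hd
  have hW : W = C⁻¹ • V.quadraticTwist d := by rw [← hC, inv_smul_smul]
  refine ⟨(⟨(C⁻¹).u, d * (C⁻¹).r, 0, 0⟩ : VariableChange ℚ) * D, ?_⟩
  rw [hW, quadraticTwist_smul, hD, smul_smul]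

/-- **B11 PER PAIR, one twist DOWN**: `V/ℚ` globally minimal with `ord_{s=1} L(V,s) = 1`, `K` imaginary quadratic with
`d_K` odd `< −4` and `p` split, `W` a globally minimal model of `V^{(d_K)}` which is an X2b pair at `p` with `K` Heegner for
`N_W` (so `K` is RAMIFIED for `V`) and `BSDp W p`; then STEP L (item -27489 BY NAME) gives `BSDp V p` — `V` is a minimal
model of `W^{(d_K)}` (`exists_smul_eq_quadraticTwist_symm`) of analytic rank one, and §2 applies. Named facts:
`PublishedInputs`, Mazur Cor. 4.1, item -27489. CONDITIONAL. [cite: CastellaEtAl2021, Thm. 5.3.1 and (5.5)–(5.7)]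
[cite: KellerYin2024, Thm. D (5.1.3) and §7 (what hSL would need; hypothesis)] [cite: MilneADT2006, Thm. I.7.3] -/
theorem bsdp_of_twistDown_cellB_bsdp_of_kRankOne (hP : EisensteinPrimes.PublishedInputs)
    (hMaz : mazur_not_dvd_maninConstant_of_odd) (hSL : EisensteinPrimes.HeegnerIndexIdentityKRankOne)
    (V : WeierstrassCurve ℚ) [V.IsElliptic] [V.IsGloballyMinimal] (p : ℕ) [Fact p.Prime] (hrV : V.analyticRank = 1)
    (K : Type) [Field K] [NumberField K] (hK : IsImaginaryQuadratic K)
    (hoddK : Odd (NumberField.discr K)) (hlt : NumberField.discr K < -4) (hHp : SatisfiesHeegnerHypothesis p K)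
    (W : WeierstrassCurve ℚ) [W.IsElliptic] [W.IsGloballyMinimal]
    (hW : ∃ C : VariableChange ℚ, C • W = V.quadraticTwist (NumberField.discr K : ℚ))
    (hc : X2.CellB W p) (hHN : SatisfiesHeegnerHypothesis (W.conductorNorm ℤ) K) (hB : BSDp W p) : BSDp V p := by
  obtain ⟨C, hC⟩ := hW
  have hd0 : (NumberField.discr K : ℚ) ≠ 0 := by exact_mod_cast NumberField.discr_ne_zero K
  obtain ⟨C', hC'⟩ := exists_smul_eq_quadraticTwist_symm V W hd0 hC
  haveI := W.isElliptic_quadraticTwist hd0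
  have hr1 : (W.quadraticTwist (NumberField.discr K : ℚ)).analyticRank = 1 := by
    have h := congrArg WeierstrassCurve.analyticRank hC'
    rw [analyticRank_smul] at h
    exact h.symm.trans hrV
  exact bsdp_partner_of_cellB_of_bsdp_of_kRankOne hP hMaz hSL W p hc hB K hK hHN hHp hoddK hlt hr1 V ⟨C', hC'⟩

/-- **B11 PER PAIR, one twist DOWN, Ш-UNIT form**: as `bsdp_of_twistDown_cellB_bsdp_of_kRankOne` with `BSDp W p` replaced by
v8's class datum at `W` (a globally minimal `W' ∼ W` with `#Ш_an(W')` a rational `p`-unit) and Wuthrich Prop. 21 BY NAME.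
CONDITIONAL. [cite: Wuthrich2014, Prop. 21 (p. 400)] [cite: CastellaEtAl2021, Thm. 5.3.1 and (5.5)–(5.7)]
[cite: KellerYin2024, Thm. D (5.1.3) and §7 (what hSL would need; hypothesis)] [cite: MilneADT2006, Thm. I.7.3] -/
theorem bsdp_of_twistDown_cellB_classShaUnit_of_kRankOne (hP : EisensteinPrimes.PublishedInputs)
    (hW21 : sha_dvd_analyticSha) (hMaz : mazur_not_dvd_maninConstant_of_odd)
    (hSL : EisensteinPrimes.HeegnerIndexIdentityKRankOne)
    (V : WeierstrassCurve ℚ) [V.IsElliptic] [V.IsGloballyMinimal] (p : ℕ) [Fact p.Prime] (hrV : V.analyticRank = 1)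
    (K : Type) [Field K] [NumberField K] (hK : IsImaginaryQuadratic K)
    (hoddK : Odd (NumberField.discr K)) (hlt : NumberField.discr K < -4) (hHp : SatisfiesHeegnerHypothesis p K)
    (W : WeierstrassCurve ℚ) [W.IsElliptic] [W.IsGloballyMinimal]
    (hW : ∃ C : VariableChange ℚ, C • W = V.quadraticTwist (NumberField.discr K : ℚ))
    (hc : X2.CellB W p) (hHN : SatisfiesHeegnerHypothesis (W.conductorNorm ℤ) K)
    (h0 : ∃ (W' : WeierstrassCurve ℚ) (_ : W'.IsElliptic) (_ : W'.IsGloballyMinimal),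
      IsIsogenous W W' ∧ ∃ q : ℚ, shaAn W' = (q : ℂ) ∧ padicValRat p q = 0) : BSDp V p :=
  bsdp_of_twistDown_cellB_bsdp_of_kRankOne hP hMaz hSL V p hrV K hK hoddK hlt hHp W hW hc hHN
    (bsdp_of_cellB_of_classShaUnit hP hW21 W p hc h0)

/-! ## §5. The v8-cone desk: STEP L from Keller–Yin Thm. D + Hsieh + LZZ (Poitou–Tate DISCHARGED, p664170) -/

/-- **THE BRICK on the v8 cone's desk**: `bsdp_partner_of_cellB_of_bsdp_of_kRankOne` with STEP L from the named facts
(x2-p1-w3 g12's `…OfNamedFacts.heegnerIndexIdentityKRankOne_of_thmD_OPEN_of_hsieh_of_thm151_thm153`: `PublishedInputs`,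
Hsieh, LZZ PUBLISHED; Keller–Yin Thm. D PRE; Poitou–Tate DISCHARGED) and Mazur Cor. 4.1. CONDITIONAL.
[claim: KellerYin2024, status: under-review] [cite: KellerYin2024, Thm. D = Thm. 5.1.3 (arXiv:2402.12781v2 L306–L309)]
[cite: CastellaEtAl2021, Thm. 5.3.1 and (5.5)–(5.7)] [cite: Mazur1978, Cor. 4.1] [cite: MilneADT2006, Thm. I.7.3] -/
theorem bsdp_partner_of_cellB_of_bsdp_of_namedFacts (hP : EisensteinPrimes.PublishedInputs)
    (hMaz : mazur_not_dvd_maninConstant_of_odd) (hH : hsieh2014_exists_anticyclotomicPAdicLFunction)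
    (hF : LiuZhangZhang2018.thm151_thm153_modularCurve_heegnerVector)
    (hD : KellerYin2024.thmD_imcMult_exists_isBDPLFunction_isTorsion_charIdeal_eq_OPEN)
    (W : WeierstrassCurve ℚ) [W.IsElliptic] [W.IsGloballyMinimal] (p : ℕ) [Fact p.Prime] (hc : X2.CellB W p)
    (hB : BSDp W p)
    (K : Type) [Field K] [NumberField K] (hK : IsImaginaryQuadratic K)
    (hHN : SatisfiesHeegnerHypothesis (W.conductorNorm ℤ) K) (hHp : SatisfiesHeegnerHypothesis p K)
    (hoddK : Odd (NumberField.discr K)) (hlt : NumberField.discr K < -4)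
    (hr1 : (W.quadraticTwist (NumberField.discr K : ℚ)).analyticRank = 1)
    (Wd : WeierstrassCurve ℚ) [Wd.IsElliptic] [Wd.IsGloballyMinimal]
    (hWd : ∃ C : VariableChange ℚ, C • Wd = W.quadraticTwist (NumberField.discr K : ℚ)) : BSDp Wd p :=
  bsdp_partner_of_cellB_of_bsdp_of_kRankOne hP hMaz
    (heegnerIndexIdentityKRankOne_of_thmD_OPEN_of_hsieh_of_thm151_thm153 hP hH hF hD) W p hc hB K hK hHN hHp hoddK hlt
    hr1 Wd hWd

/-- **EVERY Ш-UNIT X2b CLASS DELIVERS ITS PARTNERS, on the v8 cone's desk** — exactly the v8 cone {`PublishedInputs`, (2c)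
Mazur Cor. 4.1, (2f) Hsieh, (2g) LZZ, (2k) Wuthrich Prop. 21, Keller–Yin Thm. D} and NOTHING ELSE (no field supply, no
Schneider, no exceptional leading term): at every X2b pair carrying v8's Ш-unit class datum, `BSDp` at every globally minimal
model of every admissible rank-one partner. CONDITIONAL; BSD is proved for no curve. [claim: KellerYin2024, status: under-review]
[cite: KellerYin2024, Thm. D = Thm. 5.1.3 (arXiv:2402.12781v2 L306–L309)] [cite: Wuthrich2014, Prop. 21 (p. 400)]
[cite: CastellaEtAl2021, Thm. 5.3.1 and (5.5)–(5.7)] [cite: Mazur1978, Cor. 4.1] [cite: MilneADT2006, Thm. I.7.3] -/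
theorem bsdp_partner_of_cellB_of_classShaUnit_of_namedFacts (hP : EisensteinPrimes.PublishedInputs)
    (hW21 : sha_dvd_analyticSha) (hMaz : mazur_not_dvd_maninConstant_of_odd)
    (hH : hsieh2014_exists_anticyclotomicPAdicLFunction)
    (hF : LiuZhangZhang2018.thm151_thm153_modularCurve_heegnerVector)
    (hD : KellerYin2024.thmD_imcMult_exists_isBDPLFunction_isTorsion_charIdeal_eq_OPEN)
    (W : WeierstrassCurve ℚ) [W.IsElliptic] [W.IsGloballyMinimal] (p : ℕ) [Fact p.Prime] (hc : X2.CellB W p)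
    (h0 : ∃ (W' : WeierstrassCurve ℚ) (_ : W'.IsElliptic) (_ : W'.IsGloballyMinimal),
      IsIsogenous W W' ∧ ∃ q : ℚ, shaAn W' = (q : ℂ) ∧ padicValRat p q = 0)
    (K : Type) [Field K] [NumberField K] (hK : IsImaginaryQuadratic K)
    (hHN : SatisfiesHeegnerHypothesis (W.conductorNorm ℤ) K) (hHp : SatisfiesHeegnerHypothesis p K)
    (hoddK : Odd (NumberField.discr K)) (hlt : NumberField.discr K < -4)
    (hr1 : (W.quadraticTwist (NumberField.discr K : ℚ)).analyticRank = 1)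
    (Wd : WeierstrassCurve ℚ) [Wd.IsElliptic] [Wd.IsGloballyMinimal]
    (hWd : ∃ C : VariableChange ℚ, C • Wd = W.quadraticTwist (NumberField.discr K : ℚ)) : BSDp Wd p :=
  bsdp_partner_of_cellB_of_classShaUnit_of_kRankOne hP hW21 hMaz
    (heegnerIndexIdentityKRankOne_of_thmD_OPEN_of_hsieh_of_thm151_thm153 hP hH hF hD) W p hc h0 K hK hHN hHp hoddK hlt
    hr1 Wd hWd

end Summit.BirchSwinnertonDyer.BirchSwinnertonDyer.Theorems.EisensteinPrimesMazurMCOnCellBTwistbackDefectSwapUp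

end
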